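import Literature.AlgebraicGeometry.ComplexMultiplication.CMWeilSectionDichotomy
import HarnessLib

/-!
# Balanced `4`-weights on ten embeddings (total dimension `5`): divisor pairs or a Weil section of a coordinate fourfold

Sequel of `CorCM/CMWeilSectionDichotomy` (cell `pub-hodgecm2`, count-neutral sub-row A3-CM45-products; HONEST FRAMING:
combinatorial structure lemmas only — no case of the Hodge conjecture is proved here and `HC_CM` is never asserted).
Index set `⊔_i Hom(K_i, ℂ)` of a CM algebra (CM fields `K_i`, CM types `Φ_i`), `Aut(ℂ)` acting by composition,
`ρ = starRingAut`, Pohlmann's condition `IsGaloisBalancedAlg`.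

The fivefold case of the CM slice of Moonen–Zarhin 1999 (Thm. 0.2: on an abelian FIVEFOLD the codimension-`2` Hodge
classes are products of divisor classes plus pull-backs of Weil classes of quotient FOURFOLDS), again by elementary
counting:

* `section_dichotomy_of_support` — the dichotomy of the previous file for PARTIAL sections: if `τ • S` lies over the
  same conjugate pairs as `S`, then `τ • S = S`, or `τ • S = ρ • S`, or `S` splits into two nonempty balanced weights;
* `isGaloisBalancedAlg_of_moved_pair` — THE THREE-PIECE COUNT: if `S = {s₂} ⊔ A ⊔ D` and `τ • S = {y₀} ⊔ A ⊔ ρ•D` are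
  balanced with `|A| + |D| = 3`, then `|D| = 1 ⇒ A` balanced, `|D| = 2 ⇒ D` balanced, `|D| = 0 ⇒ {s₂, ρ y₀}` balanced,
  `|D| = 3 ⇒ {s₂, y₀}` balanced;
* **`mem_pohlmannDivisorSetsAlg_two_or_weilSection_five`** — for `Σ_i [K_i:ℚ] = 10` and PAIR-RIGID types (a balanced
  pair inside one block is a conjugate pair — true for primitive types, `Pohlmann1968.mem_pohlmannSets_one_iff_of_isPrimitive`,
  and trivially for imaginary quadratic blocks), every balanced `4`-subset `S` is EITHER a disjoint union of two
  balanced pairs OR a Weil section of a coordinate fourfold: `S` misses exactly one conjugate pair `{x₀, x̄₀}`, that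
  pair is `Aut(ℂ)`-stable (so its block is an imaginary quadratic field: a CM elliptic curve factor), and
  `τ • S ∈ {S, ρ • S}` for every `τ ∈ Aut(ℂ)`.

## References

* [MoonenZarhin1999LowDim] B. Moonen, Yu. Zarhin, Math. Ann. 315 (1999) 711–733, Thm. 0.2 and (2.8).
* [Gordon1999HodgeAVSurvey] B. B. Gordon, *A survey of the Hodge conjecture for abelian varieties*, §9.2, 9.2.2.
* [GaoUllmo2025] Z. Gao, E. Ullmo, J. Inst. Math. Jussieu 25 (2025), Thm. 3.1 (3.2).

Provenance: Literature home (namespace `Literature.AlgebraicGeometry.ComplexMultiplication.CMWeights`) of the Summits-side `CorCM/CMWeilSectionDichotomyFive` (cell `pub-hodgecm2`, COR-CM; all its imports are `Literature/`, Mathlib and the already re-homed `CMWeilSectionDichotomy`), which `Literature/` may not import; theorems only, no named fact, no definition. Nothing here bears on `HC_CM`. Lane `lit-hodgefound` (Layer A3: CM types, their Kubota ranks and Galois combinatorics), seat p20.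
-/

noncomputable section

open NumberField

namespace Literature.AlgebraicGeometry.ComplexMultiplication.CMWeights

open Literature.AlgebraicGeometry.Pohlmann1968 Literature.NumberTheory.ComplexMultiplication

open Literature.AlgebraicGeometry.Motives (CMType)
open Literature.AlgebraicGeometry.Pohlmann1968
open Literature.NumberTheory.ComplexMultiplication

open scoped Classical Pointwise

variable {n : ℕ} {K : Fin n → Type} [∀ i, Field (K i)] [∀ i, NumberField (K i)] [∀ i, IsCMField (K i)]

/-! ### §1 Small counting lemmas -/

omit [∀ i, NumberField (K i)] [∀ i, IsCMField (K i)] in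
/-- Counting over a singleton, member case. [cite: Gordon1999HodgeAVSurvey, 9.2.2] -/
theorem ncard_sep_singleton_mem (Φ : ∀ i, CMType (K i)) (σ : ℂ ≃+* ℂ) (a : (i : Fin n) × (K i →+* ℂ)) :
    {x | x ∈ ({a} : Finset ((i : Fin n) × (K i →+* ℂ))) ∧ (σ : ℂ →+* ℂ).comp x.2 ∈ (Φ x.1).1}.ncard =
      if (σ : ℂ →+* ℂ).comp a.2 ∈ (Φ a.1).1 then 1 else 0 := by
  split_ifs with h
  · rw [show {x | x ∈ ({a} : Finset ((i : Fin n) × (K i →+* ℂ))) ∧ (σ : ℂ →+* ℂ).comp x.2 ∈ (Φ x.1).1} = {a} by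
      ext x; simp only [Finset.mem_singleton, Set.mem_setOf_eq, Set.mem_singleton_iff]
      exact ⟨fun hx => hx.1, fun hx => ⟨hx, hx ▸ h⟩⟩]
    exact Set.ncard_singleton a
  · rw [show {x | x ∈ ({a} : Finset ((i : Fin n) × (K i →+* ℂ))) ∧ (σ : ℂ →+* ℂ).comp x.2 ∈ (Φ x.1).1} = ∅ by
      ext x; simp only [Finset.mem_singleton, Set.mem_setOf_eq, Set.mem_empty_iff_false, iff_false, not_and]
      rintro rfl; exact h]
    exact Set.ncard_empty _

omit [∀ i, NumberField (K i)] [∀ i, IsCMField (K i)] in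
/-- Counting over a singleton, non-member case. [cite: Gordon1999HodgeAVSurvey, 9.2.2] -/
theorem ncard_sep_singleton_not_mem (Φ : ∀ i, CMType (K i)) (σ : ℂ ≃+* ℂ) (a : (i : Fin n) × (K i →+* ℂ)) :
    {x | x ∈ ({a} : Finset ((i : Fin n) × (K i →+* ℂ))) ∧ (σ : ℂ →+* ℂ).comp x.2 ∉ (Φ x.1).1}.ncard =
      if (σ : ℂ →+* ℂ).comp a.2 ∈ (Φ a.1).1 then 0 else 1 := by
  split_ifs with h
  · rw [show {x | x ∈ ({a} : Finset ((i : Fin n) × (K i →+* ℂ))) ∧ (σ : ℂ →+* ℂ).comp x.2 ∉ (Φ x.1).1} = ∅ by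
      ext x; simp only [Finset.mem_singleton, Set.mem_setOf_eq, Set.mem_empty_iff_false, iff_false, not_and,
        not_not]
      rintro rfl; exact h]
    exact Set.ncard_empty _
  · rw [show {x | x ∈ ({a} : Finset ((i : Fin n) × (K i →+* ℂ))) ∧ (σ : ℂ →+* ℂ).comp x.2 ∉ (Φ x.1).1} = {a} by
      ext x; simp only [Finset.mem_singleton, Set.mem_setOf_eq, Set.mem_singleton_iff]
      exact ⟨fun hx => hx.1, fun hx => ⟨hx, hx ▸ h⟩⟩]
    exact Set.ncard_singleton a

omit [∀ i, NumberField (K i)] [∀ i, IsCMField (K i)] in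
/-- The members of `A` sent into / outside the type add up to `|A|`. [cite: Gordon1999HodgeAVSurvey, 9.2.2] -/
theorem ncard_sep_add_ncard_sep_not (Φ : ∀ i, CMType (K i)) (σ : ℂ ≃+* ℂ)
    (A : Finset ((i : Fin n) × (K i →+* ℂ))) :
    {x | x ∈ A ∧ (σ : ℂ →+* ℂ).comp x.2 ∈ (Φ x.1).1}.ncard +
      {x | x ∈ A ∧ (σ : ℂ →+* ℂ).comp x.2 ∉ (Φ x.1).1}.ncard = A.card := by
  have hdisj : Disjoint {x | x ∈ A ∧ (σ : ℂ →+* ℂ).comp x.2 ∈ (Φ x.1).1}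
      {x | x ∈ A ∧ (σ : ℂ →+* ℂ).comp x.2 ∉ (Φ x.1).1} :=
    Set.disjoint_left.mpr fun x hx hx' => hx'.2 hx.2
  have hfin₁ : {x | x ∈ A ∧ (σ : ℂ →+* ℂ).comp x.2 ∈ (Φ x.1).1}.Finite := A.finite_toSet.subset fun x hx => hx.1
  have hfin₂ : {x | x ∈ A ∧ (σ : ℂ →+* ℂ).comp x.2 ∉ (Φ x.1).1}.Finite := A.finite_toSet.subset fun x hx => hx.1
  rw [← Set.ncard_union_eq hdisj hfin₁ hfin₂,
    show {x | x ∈ A ∧ (σ : ℂ →+* ℂ).comp x.2 ∈ (Φ x.1).1} ∪ {x | x ∈ A ∧ (σ : ℂ →+* ℂ).comp x.2 ∉ (Φ x.1).1} =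
      (A : Set ((i : Fin n) × (K i →+* ℂ))) by
      ext x; simp only [Set.mem_union, Set.mem_setOf_eq, Finset.mem_coe]; tauto,
    Set.ncard_coe_finset]

omit [∀ i, NumberField (K i)] [∀ i, IsCMField (K i)] in
/-- `ρ⁻¹ = ρ` on `⊔_i Hom(K_i, ℂ)`. [cite: Gordon1999HodgeAVSurvey, 9.2.2] -/
theorem conj_inv_smul (x : (i : Fin n) × (K i →+* ℂ)) :
    (starRingAut : ℂ ≃+* ℂ)⁻¹ • x = (starRingAut : ℂ ≃+* ℂ) • x := by
  rw [inv_smul_eq_iff, conj_smul_conj_smul]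

omit [∀ i, NumberField (K i)] [∀ i, IsCMField (K i)] in
/-- `Aut(ℂ)` preserves the block index: `(τ • x).1 = x.1`. [cite: Gordon1999HodgeAVSurvey, 9.2.2] -/
theorem smul_sigma_fst (τ : ℂ ≃+* ℂ) (x : (i : Fin n) × (K i →+* ℂ)) : (τ • x).1 = x.1 := rfl

/-! ### §2 The dichotomy for partial sections over a common support -/

/-- **The dichotomy for PARTIAL sections.**  Let `S` be balanced and antipodal-free, and let `τ ∈ Aut(ℂ)` be such that
`τ • S` lies over the conjugate pairs met by `S` (`h1`) and `S` over those met by `τ • S` (`h2`).  Then `τ • S = S`, or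
`τ • S = ρ • S`, or `S = A ⊔ D` with `A`, `D` balanced and nonempty (the proof of `section_dichotomy` verbatim:
`τ • S = (S ∩ τ•S) ⊔ ρ • (S ∖ τ•S)` and the splitting lemma). [cite: Gordon1999HodgeAVSurvey, 9.2.2] -/
theorem section_dichotomy_of_support (Φ : ∀ i, CMType (K i)) {S : Finset ((i : Fin n) × (K i →+* ℂ))}
    (hS : IsGaloisBalancedAlg Φ S) (hsec : ∀ x ∈ S, (starRingAut : ℂ ≃+* ℂ) • x ∉ S) (τ : ℂ ≃+* ℂ)
    (h1 : ∀ x ∈ τ • S, x ∈ S ∨ (starRingAut : ℂ ≃+* ℂ) • x ∈ S)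
    (h2 : ∀ y ∈ S, y ∈ τ • S ∨ (starRingAut : ℂ ≃+* ℂ) • y ∈ τ • S) :
    τ • S = S ∨ τ • S = (starRingAut : ℂ ≃+* ℂ) • S ∨
    ∃ A D : Finset ((i : Fin n) × (K i →+* ℂ)), A.Nonempty ∧ D.Nonempty ∧ Disjoint A D ∧ S = A ∪ D ∧
      IsGaloisBalancedAlg Φ A ∧ IsGaloisBalancedAlg Φ D := by
  have hS'bal : IsGaloisBalancedAlg Φ (τ • S) := isGaloisBalancedAlg_smul hS τ
  have hS'sec := forall_conj_smul_not_mem_smul_finset hsec τ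
  set A := S ∩ τ • S with hA
  set D := S \ τ • S with hD
  have hSAD : S = A ∪ D := by rw [Finset.union_comm]; exact (Finset.sdiff_union_inter S (τ • S)).symm
  have hAD : Disjoint A D :=
    Finset.disjoint_left.2 fun x hx hx' => (Finset.mem_sdiff.1 hx').2 (Finset.mem_inter.1 hx).2
  have hS'eq : τ • S = A ∪ (starRingAut : ℂ ≃+* ℂ) • D := by
    ext x
    simp only [Finset.mem_union, hA, Finset.mem_inter, hD, Finset.mem_smul_finset (s := S \ τ • S),
      Finset.mem_sdiff]
    constructor
    · intro hx
      by_cases hxS : x ∈ S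
      · exact Or.inl ⟨hxS, hx⟩
      · right
        refine ⟨(starRingAut : ℂ ≃+* ℂ) • x, ⟨(h1 x hx).resolve_left hxS, fun h => hS'sec x hx h⟩, ?_⟩
        exact conj_smul_conj_smul x
    · rintro (⟨-, hx⟩ | ⟨y, ⟨hyS, hyS'⟩, rfl⟩)
      · exact hx
      · exact (h2 y hyS).resolve_left hyS'
  have hAD' : Disjoint A ((starRingAut : ℂ ≃+* ℂ) • D) := by
    rw [Finset.disjoint_left]
    rintro x hxA hx
    obtain ⟨y, hy, rfl⟩ := Finset.mem_smul_finset.1 hx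
    exact hsec y (Finset.mem_sdiff.1 hy).1 (Finset.mem_inter.1 hxA).1
  have hsplit := isGaloisBalancedAlg_split Φ hAD hAD' (hSAD ▸ hS) (hS'eq ▸ hS'bal)
  by_cases hDe : D = ∅
  · left
    have hsub : S ⊆ τ • S := fun x hx => by
      have hx' : x ∈ A ∪ D := hSAD ▸ hx
      rw [hDe, Finset.union_empty] at hx'
      exact (Finset.mem_inter.1 hx').2
    exact (Finset.eq_of_subset_of_card_le hsub (Finset.card_smul_finset τ S).le).symm
  by_cases hAe : A = ∅
  · right; left
    rw [hS'eq, hAe, Finset.empty_union, hSAD, hAe, Finset.empty_union]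
  · right; right
    exact ⟨A, D, Finset.nonempty_iff_ne_empty.2 hAe, Finset.nonempty_iff_ne_empty.2 hDe, hAD, hSAD, hsplit.1,
      hsplit.2⟩

/-! ### §3 The three-piece count for a moved pair -/

/-- **The three-piece count.**  Suppose `S = {s₂} ⊔ (A ⊔ D)` and `τ • S = {y₀} ⊔ (A ⊔ ρ•D)` (all unions disjoint) are
both balanced.  Writing, for `σ ∈ Aut(ℂ)`, `e = [σ s₂ ∈ Φ]`, `f = [σ y₀ ∈ Φ]` and `a±`, `d±` for the members of `A`,
`D` sent into / outside the type, the two conditions read `e + a⁺ + d⁺ = (1-e) + a⁻ + d⁻` and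
`f + a⁺ + d⁻ = (1-f) + a⁻ + d⁺`; hence: if `|A| = 2, |D| = 1` then `A` is balanced; if `|A| = 1, |D| = 2` then `D` is
balanced; if `|D| = 0` then the pair `{s₂, ρ y₀}` is balanced; if `|A| = 0` then the pair `{s₂, y₀}` is balanced.
 [cite: Gordon1999HodgeAVSurvey, 9.2.2] -/
theorem isGaloisBalancedAlg_of_moved_pair (Φ : ∀ i, CMType (K i)) {S A D : Finset ((i : Fin n) × (K i →+* ℂ))}
    {s₂ y₀ : (i : Fin n) × (K i →+* ℂ)} {τ : ℂ ≃+* ℂ} (hS : IsGaloisBalancedAlg Φ S)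
    (hSeq : S = {s₂} ∪ (A ∪ D)) (hS'eq : τ • S = {y₀} ∪ (A ∪ (starRingAut : ℂ ≃+* ℂ) • D))
    (hs₂ : Disjoint ({s₂} : Finset _) (A ∪ D)) (hy₀ : Disjoint ({y₀} : Finset _) (A ∪ (starRingAut : ℂ ≃+* ℂ) • D))
    (hAD : Disjoint A D) (hAD' : Disjoint A ((starRingAut : ℂ ≃+* ℂ) • D)) :
    (A.card = 2 → D.card = 1 → IsGaloisBalancedAlg Φ A) ∧
    (A.card = 1 → D.card = 2 → IsGaloisBalancedAlg Φ D) ∧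
    (D.card = 0 → Disjoint ({s₂} : Finset _) ((starRingAut : ℂ ≃+* ℂ) • ({y₀} : Finset _)) →
      IsGaloisBalancedAlg Φ ({s₂} ∪ (starRingAut : ℂ ≃+* ℂ) • ({y₀} : Finset _))) ∧
    (A.card = 0 → Disjoint ({s₂} : Finset _) ({y₀} : Finset _) →
      IsGaloisBalancedAlg Φ ({s₂} ∪ ({y₀} : Finset _))) := by
  have hS' : IsGaloisBalancedAlg Φ (τ • S) := isGaloisBalancedAlg_smul hS τ
  -- the two counting identities, for every `σ`
  have key : ∀ σ : ℂ ≃+* ℂ,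
      (if (σ : ℂ →+* ℂ).comp s₂.2 ∈ (Φ s₂.1).1 then 1 else 0) +
          {x | x ∈ A ∧ (σ : ℂ →+* ℂ).comp x.2 ∈ (Φ x.1).1}.ncard +
          {x | x ∈ D ∧ (σ : ℂ →+* ℂ).comp x.2 ∈ (Φ x.1).1}.ncard =
        (if (σ : ℂ →+* ℂ).comp s₂.2 ∈ (Φ s₂.1).1 then 0 else 1) +
          {x | x ∈ A ∧ (σ : ℂ →+* ℂ).comp x.2 ∉ (Φ x.1).1}.ncard +
          {x | x ∈ D ∧ (σ : ℂ →+* ℂ).comp x.2 ∉ (Φ x.1).1}.ncard ∧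
      (if (σ : ℂ →+* ℂ).comp y₀.2 ∈ (Φ y₀.1).1 then 1 else 0) +
          {x | x ∈ A ∧ (σ : ℂ →+* ℂ).comp x.2 ∈ (Φ x.1).1}.ncard +
          {x | x ∈ D ∧ (σ : ℂ →+* ℂ).comp x.2 ∉ (Φ x.1).1}.ncard =
        (if (σ : ℂ →+* ℂ).comp y₀.2 ∈ (Φ y₀.1).1 then 0 else 1) +
          {x | x ∈ A ∧ (σ : ℂ →+* ℂ).comp x.2 ∉ (Φ x.1).1}.ncard +
          {x | x ∈ D ∧ (σ : ℂ →+* ℂ).comp x.2 ∈ (Φ x.1).1}.ncard := by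
    intro σ
    have e₁ := hS σ
    rw [hSeq, ncard_sep_union_of_disjoint hs₂, ncard_sep_union_of_disjoint hs₂, ncard_sep_union_of_disjoint hAD,
      ncard_sep_union_of_disjoint hAD, ncard_sep_singleton_mem, ncard_sep_singleton_not_mem] at e₁
    have e₂ := hS' σ
    rw [hS'eq, ncard_sep_union_of_disjoint hy₀, ncard_sep_union_of_disjoint hy₀, ncard_sep_union_of_disjoint hAD',
      ncard_sep_union_of_disjoint hAD', ncard_sep_singleton_mem, ncard_sep_singleton_not_mem,
      ncard_sep_conj_smul_mem, ncard_sep_conj_smul_not_mem] at e₂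
    exact ⟨by omega, by omega⟩
  have hAsum := fun σ => ncard_sep_add_ncard_sep_not Φ σ A
  have hDsum := fun σ => ncard_sep_add_ncard_sep_not Φ σ D
  refine ⟨fun hA2 hD1 σ => ?_, fun hA1 hD2 σ => ?_, fun hD0 hd σ => ?_, fun hA0 hd σ => ?_⟩
  · obtain ⟨k1, k2⟩ := key σ
    have h1 := hAsum σ; have h2 := hDsum σ
    rw [hA2] at h1; rw [hD1] at h2
    split_ifs at k1 k2 <;> omega
  · obtain ⟨k1, k2⟩ := key σ
    have h1 := hAsum σ; have h2 := hDsum σ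
    rw [hA1] at h1; rw [hD2] at h2
    split_ifs at k1 k2 <;> omega
  · obtain ⟨k1, k2⟩ := key σ
    have h2 := hDsum σ
    rw [hD0] at h2
    rw [ncard_sep_union_of_disjoint hd, ncard_sep_union_of_disjoint hd, ncard_sep_singleton_mem,
      ncard_sep_singleton_not_mem, ncard_sep_conj_smul_mem, ncard_sep_conj_smul_not_mem, ncard_sep_singleton_mem,
      ncard_sep_singleton_not_mem]
    split_ifs at k1 k2 ⊢ <;> omega
  · obtain ⟨k1, k2⟩ := key σ
    have h1 := hAsum σ
    rw [hA0] at h1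
    rw [ncard_sep_union_of_disjoint hd, ncard_sep_union_of_disjoint hd, ncard_sep_singleton_mem,
      ncard_sep_singleton_not_mem, ncard_sep_singleton_mem, ncard_sep_singleton_not_mem]
    split_ifs at k1 k2 ⊢ <;> omega

end Literature.AlgebraicGeometry.ComplexMultiplication.CMWeights

end
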